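import Literature.AnabelianGeometry.SemiGraphs.TemperedReconstructionR2bProofs
import Literature.AnabelianGeometry.SemiGraphs.TemperedCompactInVerticialAt
import HarnessLib

/-!
# [SemiAnbd] Cor. 3.9, step (b), anabelioid level — part 1 AT ONE GRAPH: hosts, branches and the
# 2-cell at a branch (φ2 twin of `TemperedReconstructionR2bProofs`, proof-only)

Mochizuki, *Semi-graphs of anabelioids*, Publ. RIMS **42** (2006) [MochizukiSemiAnbd2006], Cor. 3.9,
proof, PRIMS pp. 267–268 (kurims pp. 42–43) [cite: MochizukiSemiAnbd2006, Cor 3.9 pp.42-43].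

PROOF-ONLY companion (cell abc-iut, layer L3, L3-lead rulings α4-3 (iii) / α6-1 «φ2-CONSUMERS», block
B3, seat abc-iut-w4-d083 = author of the original) of `TemperedReconstructionR2bProofs.lean`: the two
declarations there that consume the ∀-countable named fact Thm 3.7 (iii) `CompactInVerticial` —
`exists_branch_of_host` and `exists_target_branch_comm` — re-proved VERBATIM with abc-iut-w4-d075's
per-graph predicate `CompactInVerticialAt ℋ` (`TemperedCompactInVerticialAt.lean`; the frozen fact is
`∀ ℋ, CompactInVerticialAt ℋ` by `Iff.rfl`) at the ONE graph `ℋ` (the target) where the original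
instantiates it.  Port rule: `(h37iii : CompactInVerticial)` ↦ `(h37iii : CompactInVerticialAt ℋ)`,
`h37iii ℋ hℋ37 ↦ h37iii hℋ37`, decl suffix `At`; everything else verbatim; the original is untouched and
its (iii)-free lemmas (`exists_conj_comp_brHomAt`, `brHomAt_mem_branchSubgroup`,
`exists_conj_of_isVerticialHom`, …) are reused by name via the import.  Purpose: the Cor. 3.9 chain
closes for the graphs for which Thm 3.7 (iii) is in hand (finite `𝔾`, print p. 41 «since the semi-graphs
`𝔾_j` are all finite»: `compactInVerticialAt_of_finite`).  Nothing here asserts Thm 3.7 (iii) for a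
countable `𝔾`; nothing here takes a side on [IUTchIII] Cor. 3.12; typed ≠ discharged.
-/

open CategoryTheory Topology

namespace Literature.AnabelianGeometry.SemiGraphs

namespace ProfiniteSemiGraph

universe u

variable {𝒢 ℋ : ProfiniteSemiGraph.{u}}

/-! ### The host of the image of an edge group singles out a branch (Thm 3.7 (ii), (iii) AT `ℋ`) -/

/-- **Core step of [SemiAnbd] Cor. 3.9, p. 267 «compatible with the map obtained above on vertices», AT
the graph `ℋ`** (φ2 twin of `exists_branch_of_host`, Thm 3.7 (iii) taken at `ℋ` only). Let `χ` be an edge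
homomorphism of `H` at a (closed) edge `e'`, `M ≠ 1` a compact subgroup of its range, and `W` a verticial
subgroup at `w` containing `M`. Then `W` is the host of `range χ` through one of the two branches `b'` of
`e'`, this branch abuts to `w`, and `Ψ_w ∘ b'_*` is conjugate to `χ` by an element `k` with
`W = k⁻¹·Ψ_w(Π_w)·k`. [cite: MochizukiSemiAnbd2006, Cor 3.9 p.42] -/
theorem exists_branch_of_hostAt (h37i : VerticialInjective.{u}) (h37ii : VerticialDistinct.{u})
    (h37iii : CompactInVerticialAt ℋ) (hℋ : Cor39Hypotheses ℋ) (c : TemperedPiChart ℋ)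
    (Ψ : ∀ w : ℋ.graph.Vertex, ℋ.Gv w →ₜ* c.G) (hΨ : ∀ w, IsVerticialHom c w (Ψ w))
    {e' : ℋ.graph.Edge} (χ : ℋ.Ge e' →ₜ* c.G) (hχ : IsEdgeHom c e' χ)
    {M : Subgroup c.G} (hME : M ≤ χ.toMonoidHom.range) (hMc : IsCompact (M : Set c.G))
    (hMne : M ≠ ⊥) {w : ℋ.graph.Vertex} {W : Subgroup c.G} (hW : W ∈ verticialSubgroups c w)
    (hMW : M ≤ W) :
    ∃ (b' : ℋ.graph.Branch) (q : ℋ.graph.edgeOf b' = e') (h' : ℋ.graph.abuts b' = some w) (k : c.G),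
      (∀ y, k * χ y * k⁻¹ = Ψ w (ℋ.brHomAt b' w h' e' q y)) ∧
        W = (Ψ w).toMonoidHom.range.map (MulAut.conj k⁻¹).toMonoidHom := by
  classical
  have hℋ37 := hℋ.thm37Hypotheses
  obtain ⟨b₁, b₂, w₁, w₂, hb12, q₁, q₂, h₁, h₂⟩ :=
    SemiGraph.exists_branches_of_isClosedEdge (isClosedEdge_of_isGraph hℋ.isGraph e')
  obtain ⟨k₁, hk₁⟩ := exists_conj_comp_brHomAt c h₁ (Ψ w₁) (hΨ w₁) q₁ χ hχ
  obtain ⟨k₂, hk₂⟩ := exists_conj_comp_brHomAt c h₂ (Ψ w₂) (hΨ w₂) q₂ χ hχ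
  -- `range χ = kᵢ⁻¹ · Ψ(Π_{bᵢ}) · kᵢ`
  have hEle : ∀ {b : ℋ.graph.Branch} {u : ℋ.graph.Vertex} (hb : ℋ.graph.abuts b = some u)
      (q : ℋ.graph.edgeOf b = e') (k : c.G),
      (∀ y, k * χ y * k⁻¹ = Ψ u (ℋ.brHomAt b u hb e' q y)) →
        χ.toMonoidHom.range ≤
          ((ℋ.branchSubgroup b u hb).map (Ψ u).toMonoidHom).map (MulAut.conj k⁻¹).toMonoidHom := by
    intro b u hb q k hk
    rintro _ ⟨y, rfl⟩
    refine ⟨Ψ u (ℋ.brHomAt b u hb e' q y), ⟨_, brHomAt_mem_branchSubgroup hb q y, rfl⟩, ?_⟩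
    have hy : χ y = k⁻¹ * Ψ u (ℋ.brHomAt b u hb e' q y) * k⁻¹⁻¹ := by
      rw [← hk y]; group
    rw [MulEquiv.coe_toMonoidHom, MulAut.conj_apply, ContinuousMonoidHom.coe_toMonoidHom]
    exact hy.symm
  have hE₁ := hEle h₁ q₁ k₁ hk₁
  have hE₂ := hEle h₂ q₂ k₂ hk₂
  have hH₁ : (Ψ w₁).toMonoidHom.range.map (MulAut.conj k₁⁻¹).toMonoidHom ∈ verticialSubgroups c w₁ :=
    conj_mem_verticialSubgroups c (range_mem_verticialSubgroups c (Ψ w₁) (hΨ w₁)) k₁⁻¹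
  have hH₂ : (Ψ w₂).toMonoidHom.range.map (MulAut.conj k₂⁻¹).toMonoidHom ∈ verticialSubgroups c w₂ :=
    conj_mem_verticialSubgroups c (range_mem_verticialSubgroups c (Ψ w₂) (hΨ w₂)) k₂⁻¹
  have hEH₁ : χ.toMonoidHom.range ≤ (Ψ w₁).toMonoidHom.range.map (MulAut.conj k₁⁻¹).toMonoidHom :=
    hE₁.trans (Subgroup.map_mono (Subgroup.map_le_range _ _))
  have hEH₂ : χ.toMonoidHom.range ≤ (Ψ w₂).toMonoidHom.range.map (MulAut.conj k₂⁻¹).toMonoidHom :=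
    hE₂.trans (Subgroup.map_mono (Subgroup.map_le_range _ _))
  have hEne : χ.toMonoidHom.range ≠ ⊥ := fun h0 => hMne (le_bot_iff.mp (h0 ▸ hME))
  -- the two hosts are distinct (total estrangement, via `branch_eq_of_hosts_eq`)
  have hne : (Ψ w₁).toMonoidHom.range.map (MulAut.conj k₁⁻¹).toMonoidHom ≠
      (Ψ w₂).toMonoidHom.range.map (MulAut.conj k₂⁻¹).toMonoidHom := fun hEq =>
    hb12 (branch_eq_of_hosts_eq h37ii h37i hℋ37 c Ψ hΨ hEne h₁ h₂ k₁⁻¹ k₂⁻¹ hE₁ hE₂ hEq)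
  -- Thm 3.7 (iii) AT `ℋ`: `M` has exactly these two hosts
  obtain ⟨honly, -⟩ := (h37iii hℋ37 c M hMc).2 hMne w₁ w₂ _ _ hH₁ hH₂ hne
    (hME.trans hEH₁) (hME.trans hEH₂)
  rcases honly w W hW hMW with hW₁ | hW₂
  · have hw : w = w₁ := by
      by_contra hne'
      have h0 := (h37ii ℋ hℋ37 c).1 w w₁ W _ hW hH₁ hne'
      rw [hW₁, Subgroup.relIndex_self] at h0
      exact one_ne_zero h0
    subst hw
    exact ⟨b₁, q₁, h₁, k₁, hk₁, hW₁⟩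
  · have hw : w = w₂ := by
      by_contra hne'
      have h0 := (h37ii ℋ hℋ37 c).1 w w₂ W _ hW hH₂ hne'
      rw [hW₂, Subgroup.relIndex_self] at h0
      exact one_ne_zero h0
    subst hw
    exact ⟨b₂, q₂, h₂, k₂, hk₂, hW₂⟩

/-- Composition of two conjugations. [folklore] -/
private theorem conj_toMonoidHom_comp' {G : Type*} [Group G] (x y : G) :
    (MulAut.conj x).toMonoidHom.comp (MulAut.conj y).toMonoidHom = (MulAut.conj (x * y)).toMonoidHom := by
  ext z; simp [mul_assoc]

/-- **Compatibility at a branch, AT the graph `ℋ`** (φ2 twin of `exists_target_branch_comm`; [SemiAnbd]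
Cor. 3.9, proof, p. 268 «induces … compatible with the `b_*` up to inner automorphism»): given the lifts
`hV : Π_v → Π_w` (through the verticial `χ_v` at `w`) and `hE : Π_e → Π_{e'}` (through the edge
homomorphism `χ_E` at `e'`) of `φ ∘ ψ_v`, `φ ∘ ψ_E`, and `a` with `ψ_v ∘ b_* = γ_a ∘ ψ_E`, there is a
branch `b'` of `e'` abutting to `w` and `γ ∈ Π_w` with `hV ∘ b_* = γ_γ ∘ b'_* ∘ hE`; moreover the host
`(φ a)⁻¹·χ_v(Π_w)·(φ a)` of the image of the edge group is the host of `range χ_E` through `b'`.  Thm 3.7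
(iii) is taken at `ℋ` only. [cite: MochizukiSemiAnbd2006, Cor 3.9 p.43] -/
theorem exists_target_branch_commAt (h37i : VerticialInjective.{u}) (h37ii : VerticialDistinct.{u})
    (h37iii : CompactInVerticialAt ℋ) (hℋ : Cor39Hypotheses ℋ)
    (c𝒢 : TemperedPiChart 𝒢) (cℋ : TemperedPiChart ℋ) (φ : c𝒢.G →ₜ* cℋ.G)
    (Ψ : ∀ w : ℋ.graph.Vertex, ℋ.Gv w →ₜ* cℋ.G) (hΨ : ∀ w, IsVerticialHom cℋ w (Ψ w))
    {v : 𝒢.graph.Vertex} (ψv : 𝒢.Gv v →ₜ* c𝒢.G)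
    {w : ℋ.graph.Vertex} (χv : ℋ.Gv w →ₜ* cℋ.G) (hχv : IsVerticialHom cℋ w χv)
    (hVv : 𝒢.Gv v →ₜ* ℋ.Gv w) (hhV : ∀ y, χv (hVv y) = φ (ψv y))
    {b : 𝒢.graph.Branch} (hb : 𝒢.graph.abuts b = some v)
    (ψE : 𝒢.Ge (𝒢.graph.edgeOf b) →ₜ* c𝒢.G) (a : c𝒢.G)
    (ha : ∀ x, a * ψE x * a⁻¹ = ψv (𝒢.brHom b v hb x))
    {e' : ℋ.graph.Edge} (χE : ℋ.Ge e' →ₜ* cℋ.G) (hχE : IsEdgeHom cℋ e' χE)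
    (hEe : 𝒢.Ge (𝒢.graph.edgeOf b) →ₜ* ℋ.Ge e') (hhE : ∀ x, χE (hEe x) = φ (ψE x))
    (hmaps : MapsOntoOpenSubgroupOf φ.toMonoidHom ψE.toMonoidHom.range χE.toMonoidHom.range) :
    ∃ (b' : ℋ.graph.Branch) (q : ℋ.graph.edgeOf b' = e') (h' : ℋ.graph.abuts b' = some w)
      (k : cℋ.G) (γ : ℋ.Gv w),
      (∀ y, k * χE y * k⁻¹ = Ψ w (ℋ.brHomAt b' w h' e' q y)) ∧
      χv.toMonoidHom.range.map (MulAut.conj (φ a)⁻¹).toMonoidHom =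
        (Ψ w).toMonoidHom.range.map (MulAut.conj k⁻¹).toMonoidHom ∧
      ∀ x, hVv (𝒢.brHom b v hb x) = γ * ℋ.brHomAt b' w h' e' q (hEe x) * γ⁻¹ := by
  classical
  haveI := TemperedPiChart.t2Space cℋ
  have hℋ37 := hℋ.thm37Hypotheses
  -- the image `M` of the edge group
  set M : Subgroup cℋ.G := ψE.toMonoidHom.range.map φ.toMonoidHom with hMdef
  have hME : M ≤ χE.toMonoidHom.range := hmaps.1
  have hMc : IsCompact (M : Set cℋ.G) := by
    have : (M : Set cℋ.G) = Set.range (fun x => φ (ψE x)) := by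
      ext z
      simp only [hMdef, Subgroup.coe_map, MonoidHom.coe_range, Set.mem_image, Set.mem_range,
        exists_exists_eq_and]
      rfl
    rw [this]
    exact isCompact_range (φ.continuous.comp ψE.continuous)
  have hEmem : χE.toMonoidHom.range ∈ edgeLikeSubgroups cℋ e' := ⟨χE, hχE, rfl⟩
  have hMne : M ≠ ⊥ := by
    intro h0
    have h1 := relIndex_ne_zero_of_mapsOnto φ.toMonoidHom (isCompact_of_mem_edgeLikeSubgroups cℋ hEmem) hmaps
    rw [← hMdef, h0, Subgroup.relIndex_bot_left] at h1
    haveI := infinite_of_mem_edgeLikeSubgroups h37i hℋ37 cℋ hEmem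
    exact h1 Nat.card_eq_zero_of_infinite
  -- `M` lies in the verticial `(φ a)⁻¹ · χv(Π_w) · (φ a)`
  have hW : χv.toMonoidHom.range.map (MulAut.conj (φ a)⁻¹).toMonoidHom ∈ verticialSubgroups cℋ w :=
    conj_mem_verticialSubgroups cℋ (range_mem_verticialSubgroups cℋ χv hχv) _
  have hMW : M ≤ χv.toMonoidHom.range.map (MulAut.conj (φ a)⁻¹).toMonoidHom := by
    rintro _ ⟨_, ⟨x, rfl⟩, rfl⟩
    refine ⟨φ a * φ (ψE x) * (φ a)⁻¹, ⟨hVv (𝒢.brHom b v hb x), ?_⟩, ?_⟩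
    · show χv (hVv (𝒢.brHom b v hb x)) = _
      rw [hhV, ← ha, map_mul, map_mul, map_inv]
    · show (φ a)⁻¹ * (φ a * φ (ψE x) * (φ a)⁻¹) * (φ a)⁻¹⁻¹ = φ (ψE x)
      group
  obtain ⟨b', q, h', k, hk, hhost⟩ :=
    exists_branch_of_hostAt h37i h37ii h37iii hℋ cℋ Ψ hΨ χE hχE hME hMc hMne hW hMW
  -- `χv = γ_d ∘ Ψ_w`
  obtain ⟨d, hd⟩ := exists_conj_of_isVerticialHom cℋ (Ψ w) χv (hΨ w) hχv
  have hrange : χv.toMonoidHom.range = (Ψ w).toMonoidHom.range.map (MulAut.conj d).toMonoidHom :=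
    range_eq_map_conj_of_conj_eq cℋ (Ψ w) χv d hd
  -- commensurable terminality: `d⁻¹ (φ a) k⁻¹ ∈ Ψ_w(Π_w)`
  have hmem : ((φ a)⁻¹ * d)⁻¹ * k⁻¹ ∈ (Ψ w).toMonoidHom.range := by
    by_contra hn
    have h0 := (h37ii ℋ hℋ37 cℋ).2 w _ (range_mem_verticialSubgroups cℋ (Ψ w) (hΨ w)) _ _ hn
    have heq : (Ψ w).toMonoidHom.range.map (MulAut.conj ((φ a)⁻¹ * d)).toMonoidHom =
        (Ψ w).toMonoidHom.range.map (MulAut.conj k⁻¹).toMonoidHom := by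
      rw [← conj_toMonoidHom_comp', ← Subgroup.map_map, ← hrange, hhost]
    rw [heq, Subgroup.relIndex_self] at h0
    exact one_ne_zero h0
  obtain ⟨p, hp⟩ := hmem
  have hp' : Ψ w p = d⁻¹ * φ a * k⁻¹ := by
    rw [show Ψ w p = (Ψ w).toMonoidHom p from rfl, hp]; group
  have hinj : Function.Injective χv := (h37i ℋ hℋ37 cℋ w).2 χv hχv
  refine ⟨b', q, h', k, p, hk, hhost, fun x => hinj ?_⟩
  rw [hhV, ← ha, map_mul, map_mul, map_inv, ← hhE, map_mul, map_mul, map_inv, ← hd p, hp',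
    ← hd (ℋ.brHomAt b' w h' e' q (hEe x)), ← hk]
  group

end ProfiniteSemiGraph

end Literature.AnabelianGeometry.SemiGraphs
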